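import Summits.QuantumFields.BalabanUV.Beta.FP.NestedStepLawMovingBorder

/-!
# `BalabanUV.Beta.FP.NestedStepLawSliced` — road «FP» for binder row D1, RULING R-FP-48 ∕ design «ROUTE T» (owner, gen 16): THE NESTED STEP LAW FOR
# **SLICED** (GAUGE-FIXED) SYSTEMS WITH NESTED STATIC SLICES AND MOVING AVERAGING — the composite constraint `[Q₂Q₁; τ₂Q₁; τ₁]` (composite averaging,
# BLOCK axial slice applied to the block average, FINE axial slice) is the PRODUCT `P̃·[Q₁; τ₁]` with `P̃ = [[Q₂, 0],[τ₂, 0],[0, 1]]`, so the moving-border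
# factorisation of `NestedStepLawMovingBorder` applies VERBATIM: `secondVar` composite = fine `kkt H [Q₁;τ₁]` + block `kkt (effForm H [Q₁;τ₁] + G♭) P̃`, EXACTLY,
# with NO dressing, NO gauge-direction data and NO Gram∕Faddeev–Popov factor — for ARBITRARY curves `H, Q₁, Q₂, G` and STATIC slices `τ₁, τ₂`

HONEST DEPENDENCY (page 1, mandatory): continuum YM on T⁴ ⇐ BetaPertH ∧ nine spine estimates (0/9 proved); BetaPertH ⇐ (D1) ∧ (D4) ∧ CAP+tail;
G-an2-4 gates asym, D1 and NE2/3/4.  HONEST FRAMING (cell contract, verbatim): «discharging `BetaPertH` makes Bałaban's UV stability UNCONDITIONAL —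
a real constructive-QFT result; it is NOT the continuum limit and NOT the Clay problem.»  THIS MODULE is [folklore] block-matrix bookkeeping + one-variable
calculus over `NestedStepLawMovingBorder.secondVar_nestedStepLaw_movingBorder` ✓ (p302005) BY NAME; no `def`, no `def … : Prop`, nothing cited, 0 sorry; 0∕4 row-D1
binders; NOT SDF for the literal, NOT D1, NOT BetaPertH, NOT continuum, NOT Clay.  «not in print; our bookkeeping».

ABSOLUTE RULE (cell charter, verbatim): «No internally-minted statement may enter as a cited fact. Every hypothesis is either kernel-proved in this package or a
verbatim quotation of a PUBLISHED theorem with page reference. The manuscript(s) under audit are NOT citable for their own disputed steps — they are the thing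
under adjudication; programme-internal (2001/route/tribunal) claims are never citable.»

WHY (owner toy `HOME/b2b-balaban-beta-d1-p3/toy/mb_dressed_defect_exact.py` 9fce61de242ca860, exact rational arithmetic, output 1c8353ee32eb43e6; journal
[D1P3-G16-EFP162]).  The gauge-fixed one-loop object of a blocking step is `log|det kkt (H(b), [Q(b); τ])|`: the averaging `Q(b)` MOVES with the background, the
axial slice `τ` is a STATIC linear condition, and the Faddeev–Popov factor of an axial slice is background-independent.  For the COMPOSITE step with nested gauge
fixing (fine slice `τ₁` on the fine fluctuation, block slice `τ₂` on the block average) the constraint is `[Q₂(b)Q₁(b); τ₂Q₁(b); τ₁] = P̃(b)·[Q₁(b); τ₁]`.  Hence the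
UNDRESSED moving-border factorisation applies with `Q := [Q₁;τ₁]`, `P := P̃` and gives ZERO step defect for every jet — whereas the toy shows that a STATICALLY
nested-DRESSED representation of the same composite (the nested projector `Π_nest` frozen at `b = 0` while `Q₁(b)` moves) does NOT factorise
(`D″ = 0.9065…` exactly, variant V1), the defect vanishing iff the dressing's slice rows are blind to the border motion (variant V2) — the located reading for the road's
m ≥ 2 objects (R-FP-50): the composite tables must be the jets of the SLICED composite system (equivalently: a nested dressing that MOVES with the background), see
memo `N2B-DESIGN.md` §17.

CONTENTS ([folklore]; `ν` fine, `μ` block, `κ` coarse, `ρ₁` fine-slice rows, `ρ₂` block-slice rows):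
* §1 `nestedSlice Q₂ τ₂ := fromBlocks (fromRows Q₂ τ₂) 0 0 1 : Matrix ((κ ⊕ ρ₂) ⊕ ρ₁) (μ ⊕ ρ₁)`-shape written INLINE (no `def`):
  `nestedSlice_mul_fromRows` — `[[Q₂,0],[τ₂,0],[0,1]]·[Q₁;τ₁] = [[Q₂Q₁; τ₂Q₁]; τ₁]`; `compForm_fromRows_blockDiag` — `compForm H [Q₁;τ₁] (G ⊕ 0) = H + Q₁ᵀGQ₁`.
* §2 calculus plumbing: `hasDerivAt_fromRows_const` (`u ↦ [Q(u); τ]`), `hasDerivAt_nestedSlice` (`u ↦ [[Q₂(u),0],[τ₂,0],[0,D]]`), `hasDerivAt_blockDiag` (`u ↦ G(u) ⊕ 0`).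
* §3 **`secondVar_nestedStepLaw_sliced`** — for `C²` curves `H, Q₁, Q₂, G` (first-jet curves near `0`, second jets at `0`), static slices `τ₁, τ₂`, a block curve `E` with
  `E = effForm H [Q₁;τ₁] + (G ⊕ 0)` near `0`, a composite curve `(𝔎, 𝔔)` with `𝔎 = H + Q₁ᵀGQ₁`, `𝔔 = [[Q₂Q₁; τ₂Q₁]; τ₁]` near `0`, and the fine ∕ block systems
  non-degenerate at `0`: `secondVar` composite = `secondVar (kkt H [Q₁;τ₁])` + `secondVar (kkt E P̃)` at `0`, each with its own bordered jets (fine border jet `[Q̇₁; 0]`,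
  block border jet `[[Q̇₂,0],[0,0],[0,0]]`).
Provenance: road FP OWNER b2b-balaban-beta-d1-p3 gen 16 (prover-b2b-balaban-beta-d1-p3-g16-0), 2026-08-21.  Orientation only (nothing quoted is load-bearing): nested axial
gauge fixing of composite renormalization transformations is the subject of [Balaban1987RG1] §1 (1.17)–(1.22) pp. 262–264.
-/

noncomputable section

namespace Summit.QuantumFields.BalabanUV.Beta.FP.NestedStepLawSliced

open Matrix Filter Finset
open scoped Topology
open Literature.MathematicalPhysics.QuantumFieldTheory.Balaban1983to89.Beta.Composition (kkt compForm)
open Literature.MathematicalPhysics.QuantumFieldTheory.Balaban1983to89.Beta.CompositionSingular (effForm)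
open Summit.QuantumFields.BalabanUV.Beta.D1BFx.LogDetSecondVariation (secondVar)
open Summit.QuantumFields.BalabanUV.Beta.D1BFx.SliceTransferModel (hasDerivAt_entry)
open Summit.QuantumFields.BalabanUV.Beta.FP.NestedStepLawMovingBorder (secondVar_nestedStepLaw_movingBorder)

/-! ## §1 Block bookkeeping of the nested slice -/

section Blocks

variable {𝕜 : Type*} [Field 𝕜]
variable {ν μ κ ρ₁ ρ₂ : Type*} [Fintype ν] [Fintype μ] [Fintype κ] [Fintype ρ₁] [Fintype ρ₂]
  [DecidableEq ν] [DecidableEq μ] [DecidableEq κ] [DecidableEq ρ₁] [DecidableEq ρ₂]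

omit [Fintype ν] [Fintype κ] [Fintype ρ₂] [DecidableEq ν] [DecidableEq μ] [DecidableEq κ] [DecidableEq ρ₂] in
/-- [folklore] **THE COMPOSITE SLICED CONSTRAINT IS A PRODUCT**: `[[Q₂,0],[τ₂,0],[0,1]] · [Q₁; τ₁] = [[Q₂Q₁; τ₂Q₁]; τ₁]` — composite averaging, block slice on the
block average, fine slice. -/
theorem nestedSlice_mul_fromRows (Q₂ : Matrix κ μ 𝕜) (τ₂ : Matrix ρ₂ μ 𝕜) (Q₁ : Matrix μ ν 𝕜) (τ₁ : Matrix ρ₁ ν 𝕜) :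
    fromBlocks (fromRows Q₂ τ₂) (0 : Matrix (κ ⊕ ρ₂) ρ₁ 𝕜) (0 : Matrix ρ₁ μ 𝕜) (1 : Matrix ρ₁ ρ₁ 𝕜) * fromRows Q₁ τ₁
      = fromRows (fromRows (Q₂ * Q₁) (τ₂ * Q₁)) τ₁ := by
  rw [fromBlocks_mul_fromRows, Matrix.zero_mul, Matrix.zero_mul, add_zero, zero_add, Matrix.one_mul, fromRows_mul]

omit [Fintype ν] [Fintype κ] [Fintype ρ₂] [DecidableEq ν] [DecidableEq μ] [DecidableEq κ] [DecidableEq ρ₁] [DecidableEq ρ₂] in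
/-- [folklore] **THE LIFTED BLOCK TERM THROUGH THE SLICED FINE CONSTRAINT**: `compForm H [Q₁;τ₁] (G ⊕ 0) = H + Q₁ᵀGQ₁` — the slice multipliers carry no block term. -/
theorem compForm_fromRows_blockDiag (H : Matrix ν ν 𝕜) (Q₁ : Matrix μ ν 𝕜) (τ₁ : Matrix ρ₁ ν 𝕜) (G : Matrix μ μ 𝕜) :
    compForm H (fromRows Q₁ τ₁) (fromBlocks G (0 : Matrix μ ρ₁ 𝕜) (0 : Matrix ρ₁ μ 𝕜) (0 : Matrix ρ₁ ρ₁ 𝕜)) = H + Q₁ᵀ * G * Q₁ := by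
  unfold compForm
  rw [transpose_fromRows, fromCols_mul_fromBlocks, Matrix.mul_zero, Matrix.mul_zero, Matrix.mul_zero, add_zero, add_zero, fromCols_mul_fromRows,
    Matrix.zero_mul, add_zero]

end Blocks

/-! ## §2 Calculus plumbing for the sliced curves -/

section Curves

variable {ν μ κ ρ₁ ρ₂ : Type*} [Fintype ν] [Fintype μ] [Fintype κ] [Fintype ρ₁] [Fintype ρ₂] [DecidableEq ρ₁]

omit [Fintype μ] [Fintype κ] [Fintype ρ₁] [Fintype ρ₂] [DecidableEq ρ₁] in
/-- [folklore] `u ↦ [Q(u); τ]` (moving averaging, static slice) has derivative `[Q̇; 0]`. -/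
theorem hasDerivAt_fromRows_const {Q : ℝ → μ → ν → ℝ} {Q' : Matrix μ ν ℝ} {t : ℝ} (τ : Matrix ρ₁ ν ℝ) (hQ : HasDerivAt Q (Matrix.of.symm Q') t) :
    HasDerivAt (fun u => Matrix.of.symm (fromRows (Matrix.of (Q u)) τ)) (Matrix.of.symm (fromRows Q' (0 : Matrix ρ₁ ν ℝ))) t := by
  refine hasDerivAt_pi.2 fun a => hasDerivAt_pi.2 fun j => ?_
  rcases a with i | r
  · simp only [Matrix.of_symm_apply, Matrix.fromRows_apply_inl, Matrix.of_apply]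
    exact hasDerivAt_entry hQ i j
  · simp only [Matrix.of_symm_apply, Matrix.fromRows_apply_inr, Matrix.zero_apply]
    exact hasDerivAt_const _ _

omit [Fintype ν] [Fintype κ] [Fintype ρ₂] [DecidableEq ρ₁] in
/-- [folklore] `u ↦ [[Q₂(u),0],[τ₂,0],[0,D]]` (moving coarse averaging, static block slice `τ₂`, static corner `D` — `D = 1` for the nested slice, `D = 0` for its jet curve)
has derivative `[[Q̇₂,0],[0,0],[0,0]]`. -/
theorem hasDerivAt_nestedSlice {Q₂ : ℝ → κ → μ → ℝ} {Q₂' : Matrix κ μ ℝ} {t : ℝ} (τ₂ : Matrix ρ₂ μ ℝ) (D : Matrix ρ₁ ρ₁ ℝ)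
    (hQ₂ : HasDerivAt Q₂ (Matrix.of.symm Q₂') t) :
    HasDerivAt (fun u => Matrix.of.symm (fromBlocks (fromRows (Matrix.of (Q₂ u)) τ₂) (0 : Matrix (κ ⊕ ρ₂) ρ₁ ℝ) (0 : Matrix ρ₁ μ ℝ) D))
      (Matrix.of.symm (fromBlocks (fromRows Q₂' (0 : Matrix ρ₂ μ ℝ)) (0 : Matrix (κ ⊕ ρ₂) ρ₁ ℝ) (0 : Matrix ρ₁ μ ℝ) (0 : Matrix ρ₁ ρ₁ ℝ))) t := by
  refine hasDerivAt_pi.2 fun a => hasDerivAt_pi.2 fun b => ?_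
  rcases a with (k | r₂) | r₁ <;> rcases b with m | r₁'
  · simp only [Matrix.of_symm_apply, Matrix.fromBlocks_apply₁₁, Matrix.fromRows_apply_inl, Matrix.of_apply]
    exact hasDerivAt_entry hQ₂ k m
  · simp only [Matrix.of_symm_apply, Matrix.fromBlocks_apply₁₂, Matrix.zero_apply]
    exact hasDerivAt_const _ _
  · simp only [Matrix.of_symm_apply, Matrix.fromBlocks_apply₁₁, Matrix.fromRows_apply_inr, Matrix.zero_apply]
    exact hasDerivAt_const _ _
  · simp only [Matrix.of_symm_apply, Matrix.fromBlocks_apply₁₂, Matrix.zero_apply]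
    exact hasDerivAt_const _ _
  · simp only [Matrix.of_symm_apply, Matrix.fromBlocks_apply₂₁, Matrix.zero_apply]
    exact hasDerivAt_const _ _
  · simp only [Matrix.of_symm_apply, Matrix.fromBlocks_apply₂₂, Matrix.zero_apply]
    exact hasDerivAt_const _ _

omit [Fintype ν] [Fintype κ] [Fintype ρ₂] [DecidableEq ρ₁] in
/-- [folklore] `u ↦ G(u) ⊕ 0` has derivative `Ġ ⊕ 0`. -/
theorem hasDerivAt_blockDiag {G : ℝ → μ → μ → ℝ} {G' : Matrix μ μ ℝ} {t : ℝ} (hG : HasDerivAt G (Matrix.of.symm G') t) :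
    HasDerivAt (fun u => Matrix.of.symm (fromBlocks (Matrix.of (G u)) (0 : Matrix μ ρ₁ ℝ) (0 : Matrix ρ₁ μ ℝ) (0 : Matrix ρ₁ ρ₁ ℝ)))
      (Matrix.of.symm (fromBlocks G' (0 : Matrix μ ρ₁ ℝ) (0 : Matrix ρ₁ μ ℝ) (0 : Matrix ρ₁ ρ₁ ℝ))) t := by
  refine hasDerivAt_pi.2 fun a => hasDerivAt_pi.2 fun b => ?_
  rcases a with m | r <;> rcases b with m' | r'
  · simp only [Matrix.of_symm_apply, Matrix.fromBlocks_apply₁₁, Matrix.of_apply]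
    exact hasDerivAt_entry hG m m'
  · simp only [Matrix.of_symm_apply, Matrix.fromBlocks_apply₁₂, Matrix.zero_apply]
    exact hasDerivAt_const _ _
  · simp only [Matrix.of_symm_apply, Matrix.fromBlocks_apply₂₁, Matrix.zero_apply]
    exact hasDerivAt_const _ _
  · simp only [Matrix.of_symm_apply, Matrix.fromBlocks_apply₂₂, Matrix.zero_apply]
    exact hasDerivAt_const _ _

end Curves

/-! ## §3 The nested step law for sliced systems -/

section Sliced

variable {ν μ κ ρ₁ ρ₂ : Type*} [Fintype ν] [Fintype μ] [Fintype κ] [Fintype ρ₁] [Fintype ρ₂]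
  [DecidableEq ν] [DecidableEq μ] [DecidableEq κ] [DecidableEq ρ₁] [DecidableEq ρ₂]

/-- [folklore] **THE NESTED STEP LAW FOR SLICED SYSTEMS (nested static slices, moving averaging) — ZERO STEP DEFECT, NO DRESSING, NO GRAM FACTOR.**
Data: `C²` curves `H` (fine form), `Q₁` (one-step averaging), `Q₂` (coarse averaging), `G` (block term); STATIC slices `τ₁` (fine), `τ₂` (block); the block curve `E`
on `μ ⊕ ρ₁` coinciding near `0` with `effForm H [Q₁;τ₁] + (G ⊕ 0)`; the composite curve `(𝔎, 𝔔)` coinciding near `0` with `(H + Q₁ᵀGQ₁, [[Q₂Q₁; τ₂Q₁]; τ₁])`; the fine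
sliced system `kkt H(0) [Q₁(0);τ₁]` and the block system `kkt E(0) P̃(0)` (`P̃ = [[Q₂,0],[τ₂,0],[0,1]]`) non-degenerate.  CONCLUSION at `0`:
`secondVar (kkt 𝔎 𝔔)(kkt 𝔎̇ 𝔔̇)(kkt 𝔎̈ 𝔔̈) = secondVar (kkt H [Q₁;τ₁])(kkt Ḣ [Q̇₁;0])(kkt Ḧ [Q̈₁;0]) + secondVar (kkt E P̃)(kkt Ė [[Q̇₂,0],[0,0],[0,0]])(kkt Ë [[Q̈₂,0],[0,0],[0,0]])`. -/
theorem secondVar_nestedStepLaw_sliced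
    {H H₁ : ℝ → ν → ν → ℝ} {H₂ : Matrix ν ν ℝ} {Q₁ Q₁d : ℝ → μ → ν → ℝ} {Q₁dd : Matrix μ ν ℝ} {Q₂ Q₂d : ℝ → κ → μ → ℝ} {Q₂dd : Matrix κ μ ℝ}
    (hH : ∀ᶠ u in 𝓝 (0 : ℝ), HasDerivAt H (H₁ u) u) (hH₁ : HasDerivAt H₁ (Matrix.of.symm H₂) 0)
    (hQ₁ : ∀ᶠ u in 𝓝 (0 : ℝ), HasDerivAt Q₁ (Q₁d u) u) (hQ₁d : HasDerivAt Q₁d (Matrix.of.symm Q₁dd) 0)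
    (hQ₂ : ∀ᶠ u in 𝓝 (0 : ℝ), HasDerivAt Q₂ (Q₂d u) u) (hQ₂d : HasDerivAt Q₂d (Matrix.of.symm Q₂dd) 0)
    (τ₁ : Matrix ρ₁ ν ℝ) (τ₂ : Matrix ρ₂ μ ℝ) {G : ℝ → μ → μ → ℝ}
    {E E₁ : ℝ → (μ ⊕ ρ₁) → (μ ⊕ ρ₁) → ℝ} {E₂ : Matrix (μ ⊕ ρ₁) (μ ⊕ ρ₁) ℝ}
    (hE : ∀ᶠ u in 𝓝 (0 : ℝ), HasDerivAt E (E₁ u) u) (hE₁ : HasDerivAt E₁ (Matrix.of.symm E₂) 0)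
    (hEeq : ∀ᶠ u in 𝓝 (0 : ℝ), Matrix.of (E u) = effForm (Matrix.of (H u)) (fromRows (Matrix.of (Q₁ u)) τ₁)
      + fromBlocks (Matrix.of (G u)) (0 : Matrix μ ρ₁ ℝ) (0 : Matrix ρ₁ μ ℝ) (0 : Matrix ρ₁ ρ₁ ℝ))
    {𝔎 𝔎₁ : ℝ → ν → ν → ℝ} {𝔎₂ : Matrix ν ν ℝ} {𝔔 𝔔₁ : ℝ → ((κ ⊕ ρ₂) ⊕ ρ₁) → ν → ℝ} {𝔔₂ : Matrix ((κ ⊕ ρ₂) ⊕ ρ₁) ν ℝ}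
    (h𝔎 : ∀ᶠ u in 𝓝 (0 : ℝ), HasDerivAt 𝔎 (𝔎₁ u) u) (h𝔎₁ : HasDerivAt 𝔎₁ (Matrix.of.symm 𝔎₂) 0)
    (h𝔔 : ∀ᶠ u in 𝓝 (0 : ℝ), HasDerivAt 𝔔 (𝔔₁ u) u) (h𝔔₁ : HasDerivAt 𝔔₁ (Matrix.of.symm 𝔔₂) 0)
    (h𝔎eq : ∀ᶠ u in 𝓝 (0 : ℝ), Matrix.of (𝔎 u) = Matrix.of (H u) + (Matrix.of (Q₁ u))ᵀ * Matrix.of (G u) * Matrix.of (Q₁ u))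
    (h𝔔eq : ∀ᶠ u in 𝓝 (0 : ℝ), Matrix.of (𝔔 u) = fromRows (fromRows (Matrix.of (Q₂ u) * Matrix.of (Q₁ u)) (τ₂ * Matrix.of (Q₁ u))) τ₁)
    (h1 : (kkt (Matrix.of (H 0)) (fromRows (Matrix.of (Q₁ 0)) τ₁)).det ≠ 0)
    (h2 : (kkt (Matrix.of (E 0)) (fromBlocks (fromRows (Matrix.of (Q₂ 0)) τ₂) (0 : Matrix (κ ⊕ ρ₂) ρ₁ ℝ) (0 : Matrix ρ₁ μ ℝ) (1 : Matrix ρ₁ ρ₁ ℝ))).det ≠ 0) :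
    secondVar (kkt (Matrix.of (𝔎 0)) (Matrix.of (𝔔 0))) (kkt (Matrix.of (𝔎₁ 0)) (Matrix.of (𝔔₁ 0))) (kkt 𝔎₂ 𝔔₂)
      = secondVar (kkt (Matrix.of (H 0)) (fromRows (Matrix.of (Q₁ 0)) τ₁)) (kkt (Matrix.of (H₁ 0)) (fromRows (Matrix.of (Q₁d 0)) (0 : Matrix ρ₁ ν ℝ)))
          (kkt H₂ (fromRows Q₁dd (0 : Matrix ρ₁ ν ℝ)))
        + secondVar (kkt (Matrix.of (E 0)) (fromBlocks (fromRows (Matrix.of (Q₂ 0)) τ₂) (0 : Matrix (κ ⊕ ρ₂) ρ₁ ℝ) (0 : Matrix ρ₁ μ ℝ) (1 : Matrix ρ₁ ρ₁ ℝ)))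
          (kkt (Matrix.of (E₁ 0)) (fromBlocks (fromRows (Matrix.of (Q₂d 0)) (0 : Matrix ρ₂ μ ℝ)) (0 : Matrix (κ ⊕ ρ₂) ρ₁ ℝ) (0 : Matrix ρ₁ μ ℝ) (0 : Matrix ρ₁ ρ₁ ℝ)))
          (kkt E₂ (fromBlocks (fromRows Q₂dd (0 : Matrix ρ₂ μ ℝ)) (0 : Matrix (κ ⊕ ρ₂) ρ₁ ℝ) (0 : Matrix ρ₁ μ ℝ) (0 : Matrix ρ₁ ρ₁ ℝ))) := by
  -- the sliced fine constraint curve `Q♭ u := [Q₁ u; τ₁]` and the nested slice curve `P̃ u := [[Q₂ u, 0],[τ₂, 0],[0, 1]]`, as curves with their jets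
  set Qf : ℝ → (μ ⊕ ρ₁) → ν → ℝ := fun u => Matrix.of.symm (fromRows (Matrix.of (Q₁ u)) τ₁) with hQf
  set Qfd : ℝ → (μ ⊕ ρ₁) → ν → ℝ := fun u => Matrix.of.symm (fromRows (Matrix.of (Q₁d u)) (0 : Matrix ρ₁ ν ℝ)) with hQfd
  set Pn : ℝ → ((κ ⊕ ρ₂) ⊕ ρ₁) → (μ ⊕ ρ₁) → ℝ :=
    fun u => Matrix.of.symm (fromBlocks (fromRows (Matrix.of (Q₂ u)) τ₂) (0 : Matrix (κ ⊕ ρ₂) ρ₁ ℝ) (0 : Matrix ρ₁ μ ℝ) (1 : Matrix ρ₁ ρ₁ ℝ)) with hPn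
  set Pnd : ℝ → ((κ ⊕ ρ₂) ⊕ ρ₁) → (μ ⊕ ρ₁) → ℝ :=
    fun u => Matrix.of.symm (fromBlocks (fromRows (Matrix.of (Q₂d u)) (0 : Matrix ρ₂ μ ℝ)) (0 : Matrix (κ ⊕ ρ₂) ρ₁ ℝ) (0 : Matrix ρ₁ μ ℝ) (0 : Matrix ρ₁ ρ₁ ℝ))
    with hPnd
  set Gb : ℝ → (μ ⊕ ρ₁) → (μ ⊕ ρ₁) → ℝ := fun u => Matrix.of.symm (fromBlocks (Matrix.of (G u)) (0 : Matrix μ ρ₁ ℝ) (0 : Matrix ρ₁ μ ℝ) (0 : Matrix ρ₁ ρ₁ ℝ)) with hGb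
  have hQf' : ∀ᶠ u in 𝓝 (0 : ℝ), HasDerivAt Qf (Qfd u) u := by
    filter_upwards [hQ₁] with u hu
    have hu' : HasDerivAt Q₁ (Matrix.of.symm (Matrix.of (Q₁d u))) u := hu
    exact hasDerivAt_fromRows_const τ₁ hu'
  have hQfd' : HasDerivAt Qfd (Matrix.of.symm (fromRows Q₁dd (0 : Matrix ρ₁ ν ℝ))) 0 := hasDerivAt_fromRows_const (0 : Matrix ρ₁ ν ℝ) hQ₁d
  have hPn' : ∀ᶠ u in 𝓝 (0 : ℝ), HasDerivAt Pn (Pnd u) u := by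
    filter_upwards [hQ₂] with u hu
    have hu' : HasDerivAt Q₂ (Matrix.of.symm (Matrix.of (Q₂d u))) u := hu
    exact hasDerivAt_nestedSlice τ₂ (1 : Matrix ρ₁ ρ₁ ℝ) hu'
  have hPnd' : HasDerivAt Pnd (Matrix.of.symm (fromBlocks (fromRows Q₂dd (0 : Matrix ρ₂ μ ℝ)) (0 : Matrix (κ ⊕ ρ₂) ρ₁ ℝ) (0 : Matrix ρ₁ μ ℝ)
      (0 : Matrix ρ₁ ρ₁ ℝ))) 0 := hasDerivAt_nestedSlice (0 : Matrix ρ₂ μ ℝ) (0 : Matrix ρ₁ ρ₁ ℝ) hQ₂d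
  -- the three coincidences in the shapes of `NestedStepLawMovingBorder`
  have h𝔎eq' : ∀ᶠ u in 𝓝 (0 : ℝ), Matrix.of (𝔎 u) = compForm (Matrix.of (H u)) (Matrix.of (Qf u)) (Matrix.of (Gb u)) := by
    filter_upwards [h𝔎eq] with u hu
    rw [hu, hQf, hGb]; simp only [Equiv.apply_symm_apply]; rw [compForm_fromRows_blockDiag]
  have h𝔔eq' : ∀ᶠ u in 𝓝 (0 : ℝ), Matrix.of (𝔔 u) = Matrix.of (Pn u) * Matrix.of (Qf u) := by
    filter_upwards [h𝔔eq] with u hu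
    rw [hu, hPn, hQf]; simp only [Equiv.apply_symm_apply]; rw [nestedSlice_mul_fromRows]
  have hEeq' : ∀ᶠ u in 𝓝 (0 : ℝ), Matrix.of (E u) = effForm (Matrix.of (H u)) (Matrix.of (Qf u)) + Matrix.of (Gb u) := by
    filter_upwards [hEeq] with u hu
    rw [hu, hQf, hGb]; simp only [Equiv.apply_symm_apply]
  have h1' : (kkt (Matrix.of (H 0)) (Matrix.of (Qf 0))).det ≠ 0 := by rw [hQf]; simpa only [Equiv.apply_symm_apply] using h1
  have h2' : (kkt (Matrix.of (E 0)) (Matrix.of (Pn 0))).det ≠ 0 := by rw [hPn]; simpa only [Equiv.apply_symm_apply] using h2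
  have h := secondVar_nestedStepLaw_movingBorder hH hH₁ hQf' hQfd' hE hE₁ hPn' hPnd' h𝔎 h𝔎₁ h𝔔 h𝔔₁ h𝔎eq' h𝔔eq' hEeq' h1' h2'
  rw [hQf, hQfd, hPn, hPnd] at h
  simpa only [Equiv.apply_symm_apply] using h

end Sliced

end Summit.QuantumFields.BalabanUV.Beta.FP.NestedStepLawSliced

end
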